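import Literature.MathematicalPhysics.QuantumManyBody.TorusGalerkinScattering
import HarnessLib

/-!
# Bessel's inequality for the pair coefficients: `∑_n |W_L(n)|² ≤ L³ ∫ v²`

Topic `Literature/MathematicalPhysics/QuantumManyBody`, namespace `BoseGas`; theorem-only, for the
provefact `Literature.MathematicalPhysics.QuantumManyBody.BoseGas.BastiCenatiempoSchlein2021_upperBound`.

The `ℓ²` decay of the pair coefficients `W_L(n) = ∫ v e_n` replaces the decay of `V̂` used through
(intVeta) of [BastiCenatiempoSchlein2021] (`sup_r ∑_s N^κ|V̂((r-s)/N^{1-κ})||η_s| ≤ CN^{1+κ}`): for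
a potential supported in the ball of radius `R₀ < L/2` and square integrable, `L⁻³W_L(-n)e_{-n}(c)`
are the cell Fourier coefficients of the translate `z ↦ v(|z - c|)` (`c` the centre of the cell),
and Parseval on the torus gives `∑_n |W_L(n)|² = L³∫v²` (`hasSum_norm_potFT_sq`), in particular
`∑_{n∈F}|W_L(n)|² ≤ L³∫v²` for every finite `F` (`sum_norm_potFT_sq_le`).

* `hasSum_sq_cellFourierCoeff_of_lintegral` — Parseval on the cell for measurable `φ` with
  `∫_cell|φ|² < ∞` (the continuous case is `hasSum_sq_cellFourierCoeff`).

## References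

* [BastiCenatiempoSchlein2021] G. Basti, S. Cenatiempo, B. Schlein, Forum Math. Sigma 9 (2021) e74,
  arXiv:2101.06222: §2 (intVeta).
-/

noncomputable section

open MeasureTheory Filter Set WithLp Complex Metric
open scoped ENNReal NNReal Topology ComplexConjugate BigOperators

namespace Literature.MathematicalPhysics.QuantumManyBody.BoseGas

/-! ### Parseval on the cell for square-integrable data -/

/-- **Parseval on the cell** for measurable `φ` with `∫_cell|φ|² < ∞`:
`∑ₙ ‖ĉₙ(φ)‖² = L⁻³ ∫_{[0,L)³} ‖φ‖²` (the continuous case is `hasSum_sq_cellFourierCoeff`; as there,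
the torus `(ℝ/ℤ)³` carries the Haar probability measure, introduced locally inside the proof).
[folklore] -/
theorem hasSum_sq_cellFourierCoeff_of_lintegral {L : ℝ} (hL : 0 < L) {φ : Space → ℂ} (hφ : Measurable φ)
    (hfin : (∫⁻ x in cell L, (‖φ x‖₊ : ℝ≥0∞) ^ 2) ≠ ⊤) :
    HasSum (fun n => ‖cellFourierCoeff L φ n‖ ^ 2) ((L ^ 3)⁻¹ * ∫ x in cell L, ‖φ x‖ ^ 2) := by
  letI : MeasureSpace UnitAddCircle := ⟨AddCircle.haarAddCircle⟩
  haveI : IsProbabilityMeasure (volume : Measure UnitAddCircle) :=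
    inferInstanceAs (IsProbabilityMeasure AddCircle.haarAddCircle)
  haveI : IsProbabilityMeasure (volume : Measure (UnitAddTorus (Fin 3))) := by
    rw [volume_pi]; infer_instance
  -- `torusFun L φ ∈ L²`
  have hf : MemLp (torusFun L φ) 2 volume := by
    have hmeas : AEStronglyMeasurable (torusFun L φ) volume :=
      (hφ.comp (measurable_fromUnitTorus L)).aestronglyMeasurable
    refine ⟨hmeas, ?_⟩
    rw [eLpNorm_lt_top_iff_lintegral_rpow_enorm_lt_top two_ne_zero ENNReal.ofNat_ne_top]
    have h := lintegral_fromUnitTorus hL (G := fun x => (‖φ x‖₊ : ℝ≥0∞) ^ 2) (hφ.nnnorm.coe_nnreal_ennreal.pow_const 2)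
    have hG : ∀ t, ‖torusFun L φ t‖ₑ ^ (2 : ℝ≥0∞).toReal = (fun x => (‖φ x‖₊ : ℝ≥0∞) ^ 2) (fromUnitTorus L t) := by
      intro t
      simp only [ENNReal.toReal_ofNat, ENNReal.rpow_two, torusFun, enorm_eq_nnnorm]
    simp only [hG]
    exact h.trans_lt (ENNReal.mul_lt_top (ENNReal.inv_lt_top.2 (by positivity)) (lt_top_iff_ne_top.2 hfin))
  have hP := UnitAddTorus.hasSum_sq_mFourierCoeff (hf.toLp _)
  have hcoeff : ∀ n, UnitAddTorus.mFourierCoeff (hf.toLp _ : UnitAddTorus (Fin 3) → ℂ) n =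
      cellFourierCoeff L φ n := fun n =>
    integral_congr_ae (hf.coeFn_toLp.mono fun t ht => by simp only [ht])
  have hnorm : ∫ t, ‖(hf.toLp _ : UnitAddTorus (Fin 3) → ℂ) t‖ ^ 2 = ∫ t, ‖torusFun L φ t‖ ^ 2 :=
    integral_congr_ae (hf.coeFn_toLp.mono fun t ht => by simp only [ht])
  simp only [hcoeff, hnorm] at hP
  have htr := integral_fromUnitTorus hL (fun x : Space => ‖φ x‖ ^ 2)
  simp only [smul_eq_mul] at htr
  unfold torusFun at hP
  rwa [htr] at hP

/-! ### The translated potential and its cell coefficients -/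

section Potential

variable {v : ℝ → ℝ≥0∞} {L R₀ : ℝ}

/-- The ball of radius `R₀ < L/2` about the centre lies in the cell. [folklore] -/
theorem mem_cell_of_norm_sub_centre_le (hR : 2 * R₀ < L) {x : Space} (hx : ‖x - toLp 2 (fun _ : Fin 3 => L / 2)‖ ≤ R₀) :
    x ∈ cell L := by
  intro k
  have hk : |x k - L / 2| ≤ R₀ := by
    have h1 : ‖(x - toLp 2 (fun _ : Fin 3 => L / 2)) k‖ ≤ ‖x - toLp 2 (fun _ : Fin 3 => L / 2)‖ :=
      PiLp.norm_apply_le _ k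
    have h2 : (x - toLp 2 (fun _ : Fin 3 => L / 2)) k = x k - L / 2 := rfl
    rw [h2, Real.norm_eq_abs] at h1
    exact h1.trans hx
  rw [abs_le] at hk
  have hR0 : 2 * R₀ < L := hR
  constructor <;> linarith [hk.1, hk.2]

/-- Off the cell the translated potential vanishes (`v = 0` beyond `R₀ < L/2`). [folklore] -/
theorem pot_sub_centre_eq_zero (hsupp : ∀ r, R₀ < r → v r = 0) (hR : 2 * R₀ < L) {x : Space} (hx : x ∉ cell L) :
    v ‖x - toLp 2 (fun _ : Fin 3 => L / 2)‖ = 0 := by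
  by_contra h
  exact hx (mem_cell_of_norm_sub_centre_le hR (le_of_not_gt fun h' => h (hsupp _ h')))

/-- **The cell coefficients of the translated potential**:
`ĉ_n(v(|· - c|)) = L⁻³ e_{-n}(c) W_L(-n)`. [folklore] -/
theorem cellFourierCoeff_pot_sub_centre (hL : 0 < L) (hsupp : ∀ r, R₀ < r → v r = 0) (hR : 2 * R₀ < L)
    (n : Momentum) :
    cellFourierCoeff L (fun x => ((v ‖x - toLp 2 (fun _ : Fin 3 => L / 2)‖).toReal : ℂ)) n =
      ((L ^ 3)⁻¹ : ℝ) • (cellWave L (-n) (toLp 2 (fun _ : Fin 3 => L / 2)) * potFT v L (-n)) := by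
  rw [cellFourierCoeff_eq_integral hL]
  congr 1
  rw [← integral_pot_sub_mul_cellWave v L (-n) (toLp 2 (fun _ : Fin 3 => L / 2))]
  -- the integrand vanishes off the cell
  rw [← integral_indicator (measurableSet_cell L)]
  refine integral_congr_ae (Eventually.of_forall fun x => ?_)
  by_cases hx : x ∈ cell L
  · rw [indicator_of_mem hx, conj_cellWave]; ring
  · rw [indicator_of_notMem hx]
    simp only [pot_sub_centre_eq_zero hsupp hR hx, ENNReal.toReal_zero, Complex.ofReal_zero, zero_mul]

/-- **Parseval for the pair coefficients**: `∑_n |W_L(n)|² = L³ ∫ v²` for a square-integrable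
potential supported in the ball of radius `R₀ < L/2`. [folklore] -/
theorem hasSum_norm_potFT_sq (hL : 0 < L) (hv : Measurable v) (hsupp : ∀ r, R₀ < r → v r = 0) (hR : 2 * R₀ < L)
    (h2 : (∫⁻ z : Space, v ‖z‖ ^ 2) ≠ ⊤) :
    HasSum (fun n : Momentum => ‖potFT v L n‖ ^ 2) (L ^ 3 * ∫ z : Space, (v ‖z‖).toReal ^ 2) := by
  set c : Space := toLp 2 (fun _ : Fin 3 => L / 2) with hc
  set φ : Space → ℂ := fun x => ((v ‖x - c‖).toReal : ℂ) with hφ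
  have hφm : Measurable φ :=
    Complex.measurable_ofReal.comp ((hv.comp ((measurable_id.sub_const c).norm)).ennreal_toReal)
  -- `∫_cell |φ|² = ∫ v² < ∞`
  have hsq : ∀ x : Space, (‖φ x‖₊ : ℝ≥0∞) ^ 2 = ENNReal.ofReal ((v ‖x - c‖).toReal ^ 2) := by
    intro x
    rw [coe_nnnorm_sq_eq_ofReal]
    simp only [hφ, Complex.norm_real, Real.norm_eq_abs, sq_abs]
  have hvsq : ∀ r, ENNReal.ofReal ((v r).toReal ^ 2) = (v r) ^ 2 ∨ v r = ⊤ := by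
    intro r
    by_cases h : v r = ⊤
    · exact Or.inr h
    · left; rw [ENNReal.ofReal_pow ENNReal.toReal_nonneg, ENNReal.ofReal_toReal h]
  -- a.e. finiteness of `v(|z|)`: from `∫ v² < ∞`
  have hae : ∀ᵐ z : Space, v ‖z - c‖ ≠ ⊤ := by
    have hmeas : AEMeasurable (fun z : Space => v ‖z - c‖ ^ 2) volume :=
      ((hv.comp ((measurable_id.sub_const c).norm)).pow_const 2).aemeasurable
    have hfin : (∫⁻ z : Space, v ‖z - c‖ ^ 2) ≠ ⊤ := by
      rw [show (fun z : Space => v ‖z - c‖ ^ 2) = fun z => (fun y : Space => v ‖y‖ ^ 2) (z - c) from rfl,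
        lintegral_sub_right_eq_self (fun y : Space => v ‖y‖ ^ 2) c]
      exact h2
    filter_upwards [ae_lt_top' hmeas hfin] with z hz
    intro h
    rw [h, ENNReal.top_pow two_ne_zero] at hz
    exact lt_irrefl _ hz
  have hlin : (∫⁻ x in cell L, (‖φ x‖₊ : ℝ≥0∞) ^ 2) = ∫⁻ z : Space, v ‖z‖ ^ 2 := by
    rw [← lintegral_indicator (measurableSet_cell L)]
    have hind : (fun x => (cell L).indicator (fun x => (‖φ x‖₊ : ℝ≥0∞) ^ 2) x) =ᵐ[volume]
        fun x => v ‖x - c‖ ^ 2 := by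
      filter_upwards [hae] with x hx
      by_cases hxc : x ∈ cell L
      · rw [indicator_of_mem hxc, hsq]
        rcases hvsq ‖x - c‖ with h | h
        · exact h
        · exact absurd h hx
      · rw [indicator_of_notMem hxc, pot_sub_centre_eq_zero hsupp hR hxc]; simp
    rw [lintegral_congr_ae hind]
    exact lintegral_sub_right_eq_self (fun y : Space => v ‖y‖ ^ 2) c
  have hfin : (∫⁻ x in cell L, (‖φ x‖₊ : ℝ≥0∞) ^ 2) ≠ ⊤ := by rw [hlin]; exact h2
  have hP := hasSum_sq_cellFourierCoeff_of_lintegral hL hφm hfin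
  -- identify the coefficients and the integral
  have hcoef : ∀ n, ‖cellFourierCoeff L φ n‖ ^ 2 = (L ^ 3)⁻¹ ^ 2 * ‖potFT v L (-n)‖ ^ 2 := by
    intro n
    rw [hφ, cellFourierCoeff_pot_sub_centre hL hsupp hR n, norm_smul, norm_mul, norm_cellWave, one_mul,
      Real.norm_of_nonneg (by positivity), mul_pow]
  have hint : ∫ x in cell L, ‖φ x‖ ^ 2 = ∫ z : Space, (v ‖z‖).toReal ^ 2 := by
    rw [← integral_indicator (measurableSet_cell L)]
    have hind : (fun x => (cell L).indicator (fun x => ‖φ x‖ ^ 2) x) = fun x => (v ‖x - c‖).toReal ^ 2 := by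
      funext x
      by_cases hxc : x ∈ cell L
      · rw [indicator_of_mem hxc]; simp only [hφ, Complex.norm_real, Real.norm_eq_abs, sq_abs]
      · rw [indicator_of_notMem hxc, pot_sub_centre_eq_zero hsupp hR hxc]; simp
    rw [hind]
    exact integral_sub_right_eq_self (fun y : Space => (v ‖y‖).toReal ^ 2) c
  simp only [hcoef, hint] at hP
  -- rescale and reindex `n ↦ -n`
  have hL3 : (0 : ℝ) < L ^ 3 := by positivity
  have h1 := hP.mul_left ((L ^ 3) ^ 2)
  have hf : (fun i : Momentum => (L ^ 3) ^ 2 * ((L ^ 3)⁻¹ ^ 2 * ‖potFT v L (-i)‖ ^ 2)) =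
      fun n => ‖potFT v L (-n)‖ ^ 2 := by
    funext n; field_simp
  have hs : (L ^ 3) ^ 2 * ((L ^ 3)⁻¹ * ∫ z : Space, (v ‖z‖).toReal ^ 2) = L ^ 3 * ∫ z : Space, (v ‖z‖).toReal ^ 2 := by
    field_simp
  rw [hf, hs] at h1
  have h3 := (Equiv.neg Momentum).hasSum_iff.2 h1
  have hcomp : ((fun n : Momentum => ‖potFT v L (-n)‖ ^ 2) ∘ (Equiv.neg Momentum)) = fun n => ‖potFT v L n‖ ^ 2 := by
    funext n; simp
  rwa [hcomp] at h3

/-- **Bessel for the pair coefficients**: `∑_{n ∈ F} |W_L(n)|² ≤ L³ ∫ v²` for every finite set of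
momenta. [cite: BastiCenatiempoSchlein2021, §2 (intVeta) (the `ℓ²` substitute)] -/
theorem sum_norm_potFT_sq_le (hL : 0 < L) (hv : Measurable v) (hsupp : ∀ r, R₀ < r → v r = 0) (hR : 2 * R₀ < L)
    (h2 : (∫⁻ z : Space, v ‖z‖ ^ 2) ≠ ⊤) (F : Finset Momentum) :
    ∑ n ∈ F, ‖potFT v L n‖ ^ 2 ≤ L ^ 3 * ∫ z : Space, (v ‖z‖).toReal ^ 2 :=
  sum_le_hasSum F (fun _ _ => sq_nonneg _) (hasSum_norm_potFT_sq hL hv hsupp hR h2)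

/-! ### From `L³` to `L²` on the support -/

/-- **`∫ v² ≤ (∫ v³)^{2/3} |B_{R₀}|^{1/3}`** for a potential vanishing beyond `R₀` (Hölder with
exponents `3/2, 3` against the indicator of the ball). [folklore] -/
theorem lintegral_pot_sq_le (hv : Measurable v) (hsupp : ∀ r, R₀ < r → v r = 0) :
    (∫⁻ z : Space, v ‖z‖ ^ 2) ≤
      (∫⁻ z : Space, v ‖z‖ ^ 3) ^ (2 / 3 : ℝ) * (volume (closedBall (0 : Space) R₀)) ^ (1 / 3 : ℝ) := by
  have hpq : (3 / 2 : ℝ).HolderConjugate 3 := Real.holderConjugate_iff.2 ⟨by norm_num, by norm_num⟩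
  set f : Space → ℝ≥0∞ := fun z => v ‖z‖ ^ 2 with hf
  set g : Space → ℝ≥0∞ := (closedBall (0 : Space) R₀).indicator 1 with hg
  have hfm : AEMeasurable f volume := ((hv.comp measurable_norm).pow_const 2).aemeasurable
  have hgm : AEMeasurable g volume := (aemeasurable_indicator_iff measurableSet_closedBall).2 aemeasurable_const
  have h := ENNReal.lintegral_mul_le_Lp_mul_Lq volume hpq hfm hgm
  -- `f * g = f`
  have hfg : (fun z => (f * g) z) = f := by
    funext z
    simp only [Pi.mul_apply, hg]
    by_cases hz : z ∈ closedBall (0 : Space) R₀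
    · rw [indicator_of_mem hz, Pi.one_apply, mul_one]
    · rw [indicator_of_notMem hz, mul_zero, hf]
      simp only
      rw [hsupp ‖z‖ (by simpa [mem_closedBall, dist_zero_right] using hz), zero_pow two_ne_zero]
  rw [hfg] at h
  -- exponents
  have hfp : ∀ z, f z ^ (3 / 2 : ℝ) = v ‖z‖ ^ 3 := by
    intro z
    rw [hf]
    simp only
    rw [← ENNReal.rpow_natCast, ← ENNReal.rpow_mul, ← ENNReal.rpow_natCast]
    norm_num
  have hgq : ∀ z, g z ^ (3 : ℝ) = g z := by
    intro z
    rw [hg]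
    by_cases hz : z ∈ closedBall (0 : Space) R₀
    · rw [indicator_of_mem hz, Pi.one_apply, ENNReal.one_rpow]
    · rw [indicator_of_notMem hz, ENNReal.zero_rpow_of_pos (by norm_num)]
  simp only [hfp, hgq] at h
  rw [hg, lintegral_indicator measurableSet_closedBall] at h
  have h1 : (∫⁻ a in closedBall (0 : Space) R₀, (1 : Space → ℝ≥0∞) a) = volume (closedBall (0 : Space) R₀) := by
    simp only [Pi.one_apply, lintegral_one, Measure.restrict_apply_univ]
  -- porcelain: `1/(3/2) = 2/3`
  have e1 : (1 / (3 / 2) : ℝ) = 2 / 3 := by norm_num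
  rw [h1, e1] at h
  exact h

end Potential

end Literature.MathematicalPhysics.QuantumManyBody.BoseGas

end
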